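import Summits.CriticalPhenomena.PercolationContinuityZ3.Theorems.SahiMasterFamilyGluedCross

/-!
# The local-to-global step with at most three non-pure members — hence LG_6, (TT_6) and `MasterFamilyIdentEqIff 6`

Unit `prim-master-conj` (crux anchor stmt-CriticalPhenomena-4575), gen 12; memo HOME/prim-master-conj/TIGHTNESS-IV.md §5.
Setting `GluedSetting` + a core-free coordinate, pure members `P`, non-pure members `N`.  With (α) (`two_le_card_pureFail_gann`) and the CROSS
lemma (`two_le_card_cross`) at every order:

* `structured_insert_two` — for two distinct non-pure members `u ≠ v` the family `P + u + v` is structured: the chain (pure members, `u`, `v`) with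
  the glued frames; the robustness sets containing `u` are structured because, by the cross lemma, every annihilator point of `u` fails two pure
  members failing at the given annihilator point of `v`;
* `false_of_card_nonpure_le_three` — under "no structured deletion", at most three non-pure members is impossible (delete a non-pure member;
  the rest is `P`, `P + u` or `P + u + v`);
* **`localToGlobal_two : LocalToGlobal 2`** (six members: `|P| = 2` is `false_of_alpha`, otherwise `|N| ≤ 3`), **`terminalTight_three`**, and
* **`masterFamilyIdentEqIff_six : MasterFamilyIdentEqIff 6`** — for increasing events `U₁,…,U₆` on a finite product of two-point spaces,
  `E₆(μ_p; 1_{U₁},…,1_{U₆}) = 0` for every `p` in the open cube iff `(U₁,…,U₆) ∈ Z₆`.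
Also `localToGlobal_of_card_nonpure_le_three`: LG_k at every order whenever `|P| = 2` or `|N| ≤ 3`.  What remains for every order is the
MULTI-CROSS lemma (TIGHTNESS-IV §5).  Pure combinatorics; axioms standard. [this work]
-/

noncomputable section

open scoped Classical

namespace Summit.CriticalPhenomena.PercolationContinuityZ3.Theorems

namespace GluedFrames

open Finset Function
open Literature.Probability.LatticeModels.Kahn2022 (Affects)

variable {ι : Type*} [Fintype ι] {κ : Type*} {U : κ → Set (Set ι)} {W : Finset κ}

namespace GluedSetting

variable (G : GluedSetting U W)
include G

/-- The pure members have pairwise disjoint supports. [this work] -/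
theorem pures_pairwise_disjoint :
    ∀ w ∈ W.filter (fun p => gann U W p = ∅), ∀ w' ∈ W.filter (fun p => gann U W p = ∅), w ≠ w' →
      Disjoint (esupp (U w)) (esupp (U w')) := by
  intro w hw w' hw' hww'
  rw [mem_filter] at hw hw'
  have := G.hd w hw.1 w' hw'.1 hww'
  rwa [G.gframe_eq_of_pure hw.2, G.gframe_eq_of_pure hw'.2] at this

/-- **`P + u + v` is structured** for distinct non-pure members `u, v` (from (α) and the cross lemma; some coordinate core-free). [this work] -/
theorem structured_insert_two (hE0 : ∃ f, CoreFree U f) {u v : κ} (huv : u ≠ v) (huN : (gann U W u).Nonempty)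
    (hvN : (gann U W v).Nonempty) :
    Structured U (insert v (insert u (W.filter fun p => gann U W p = ∅))) := by
  have hU := G.hU
  have hu : u ∈ W := G.hWU u
  have hv : v ∈ W := G.hWU v
  set P := W.filter fun p => gann U W p = ∅ with hPdef
  set SP : Set ι := ⋃ p ∈ P, (↑(esupp (U p)) : Set ι) with hSPdef
  have huP : u ∉ P := fun h => huN.ne_empty (mem_filter.1 h).2
  have hvP : v ∉ P := fun h => hvN.ne_empty (mem_filter.1 h).2
  have hdP := G.pures_pairwise_disjoint
  -- the chain of the pure members
  set l := P.toList with hldef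
  have hn : l.Nodup := P.nodup_toList
  have hlP : l.toFinset = P := P.toList_toFinset
  have hdl : ∀ w ∈ l, ∀ w' ∈ l, w ≠ w' → Disjoint (esupp (U w)) (esupp (U w')) :=
    fun w hw w' hw' hne => hdP w (mem_toList.1 hw) w' (mem_toList.1 hw') hne
  have hl : GoodChain U l := goodChain_of_pairwise_disjoint U hU hn hdl
  have hfs : frameSupp U l = SP := by rw [(frameIn_eq_self_of_pairwise_disjoint U hU hn hdl).2, hlP]
  have hSPu : Disjoint SP ↑(esupp (gframe U W u)) := disjoint_pureUnion_esupp_gframe U W hU G.hd hu huN.ne_empty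
  have hSPv : Disjoint SP ↑(esupp (gframe U W v)) := disjoint_pureUnion_esupp_gframe U W hU G.hd hv hvN.ne_empty
  have hαu := fun χ hχ => G.two_le_card_pureFail_gann hE0 (y := u) (χ := χ) hχ
  have hαv := fun χ hχ => G.two_le_card_pureFail_gann hE0 (y := v) (χ := χ) hχ
  -- frames over the pure supports are the glued frames
  have hcovu : ∀ χ ∈ gann U W u, ∃ p, χ ∉ U p ∧ ↑(esupp (U p)) ⊆ SP := by
    intro χ hχ
    obtain ⟨p, hp, -⟩ := one_lt_card.1 (hαu χ hχ) |>.imp fun p h => h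
    · rw [mem_filter] at hp
      exact ⟨p, hp.2, fun x hx => Set.mem_biUnion hp.1 hx⟩
  have hgu : hull SP (U u) = gframe U W u := (gframe_eq_hull_of_cover U W hU G.hne hSPu hcovu).symm
  -- `u` appended to the pure chain
  have hlu : GoodChain U (u :: l) := by
    rw [goodChain_cons]
    refine ⟨hl, fun h => huP (mem_toList.1 h), ?_⟩
    intro φ hφ
    rw [hfs, hgu] at hφ
    rw [hlP, mem_safe]
    refine ⟨?_, fun R _ hRP => structured_of_pairwise_disjoint U hU fun w hw w' hw' hne => hdP w (hRP hw) w' (hRP hw') hne⟩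
    have : failSet U P φ = P.filter fun p => φ ∉ U p := rfl
    rw [this]; exact hαu φ hφ
  have hfsu : frameSupp U (u :: l) = SP ∪ ↑(esupp (gframe U W u)) := by
    rw [frameSupp_cons, frameIn_cons_self, hfs, hgu]
  -- `v` appended
  have hTv : Disjoint (SP ∪ ↑(esupp (gframe U W u))) ↑(esupp (gframe U W v)) := by
    rw [Set.disjoint_union_left]
    exact ⟨hSPv, disjoint_coe.2 (G.hd u hu v hv huv)⟩
  have hcovv : ∀ χ ∈ gann U W v, ∃ p, χ ∉ U p ∧ ↑(esupp (U p)) ⊆ SP ∪ ↑(esupp (gframe U W u)) := by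
    intro χ hχ
    obtain ⟨p, hp, -⟩ := one_lt_card.1 (hαv χ hχ) |>.imp fun p h => h
    · rw [mem_filter] at hp
      exact ⟨p, hp.2, fun x hx => Or.inl (Set.mem_biUnion hp.1 hx)⟩
  have hgv : hull (SP ∪ ↑(esupp (gframe U W u))) (U v) = gframe U W v := (gframe_eq_hull_of_cover U W hU G.hne hTv hcovv).symm
  have hluv : GoodChain U (v :: u :: l) := by
    rw [goodChain_cons]
    refine ⟨hlu, ?_, ?_⟩
    · simp only [List.mem_cons, not_or]
      exact ⟨fun h => huv h.symm, fun h => hvP (mem_toList.1 h)⟩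
    intro φ hφ
    rw [hfsu, hgv] at hφ
    have hPφ := hαv φ hφ
    rw [List.toFinset_cons, hlP, mem_safe]
    refine ⟨hPφ.trans (card_le_card fun p hp => ?_), fun R hFR hRu => ?_⟩
    · rw [mem_filter] at hp
      exact (mem_failSet U).2 ⟨mem_insert_of_mem hp.1, hp.2⟩
    · by_cases huR : u ∈ R
      · -- `R = P'' + u` with `P'' ⊇` the pure members failing at `φ`: structured by the cross lemma
        set P'' := R.erase u with hP''def
        have hP''P : P'' ⊆ P := by
          intro x hx
          have hxR := mem_of_mem_erase hx
          rcases mem_insert.1 (hRu hxR) with h | h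
          · exact absurd h (ne_of_mem_erase hx)
          · exact h
        have hR : R = insert u P'' := by rw [hP''def, insert_erase huR]
        rw [hR]
        refine structured_insert_of_pairwise_disjoint U hU (notMem_erase u R)
          (fun w hw w' hw' hne => hdP w (hP''P hw) w' (hP''P hw') hne) fun ψ hψ hψU => ?_
        have hψg : ψ ∈ gframe U W u := by
          refine hull_subset_gframe U W hU ?_ hψ
          rw [Set.disjoint_iUnion₂_left]
          intro p hp
          exact (Set.disjoint_iUnion₂_left.1 hSPu) p (hP''P hp)
        refine (G.two_le_card_cross' hE0 huv ⟨hψg, hψU⟩ hφ).trans (card_le_card fun p hp => ?_)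
        simp only [mem_filter] at hp ⊢
        refine ⟨mem_erase.2 ⟨?_, hFR ((mem_failSet U).2 ⟨mem_insert_of_mem (mem_filter.2 hp.1.1), hp.2⟩)⟩, hp.1.2⟩
        rintro rfl; exact huP (mem_filter.2 hp.1.1)
      · -- `R ⊆ P`: pure, independent
        refine structured_of_pairwise_disjoint U hU fun w hw w' hw' hne => hdP w ?_ w' ?_ hne
        · rcases mem_insert.1 (hRu hw) with h | h
          · exact absurd h (fun e => huR (e ▸ hw))
          · exact h
        · rcases mem_insert.1 (hRu hw') with h | h
          · exact absurd h (fun e => huR (e ▸ hw'))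
          · exact h
  refine ⟨v :: u :: l, ?_, hluv⟩
  rw [List.toFinset_cons, List.toFinset_cons, hlP]

omit G in
/-- The deletion of a non-pure member `w` consists of the pure members and the other non-pure members. [this work] -/
theorem mem_erase_iff_of_nonpure {w : κ} (hwN : gann U W w ≠ ∅) (x : κ) :
    x ∈ W.erase w ↔ x ∈ (W.filter fun p => gann U W p = ∅) ∨ x ∈ (W.filter fun p : κ => gann U W p ≠ ∅).erase w := by
  simp only [mem_erase, mem_filter]
  constructor
  · rintro ⟨hxw, hx⟩
    by_cases h : gann U W x = ∅
    · exact Or.inl ⟨hx, h⟩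
    · exact Or.inr ⟨hxw, hx, h⟩
  · rintro (⟨hx, h⟩ | ⟨hxw, hx, -⟩)
    · exact ⟨fun e => hwN (e ▸ h), hx⟩
    · exact ⟨hxw, hx⟩

/-- **At most three non-pure members contradict "no structured deletion"** (some coordinate core-free, `W` non-empty). [this work] -/
theorem false_of_card_nonpure_le_three (hE0 : ∃ f, CoreFree U f) (hdel : ∀ x ∈ W, ¬ Structured U (W.erase x))
    (hN : (W.filter fun p : κ => gann U W p ≠ ∅).card ≤ 3) (hW : W.Nonempty) : False := by
  have hU := G.hU
  set P := W.filter fun p => gann U W p = ∅ with hPdef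
  set N := W.filter fun p : κ => gann U W p ≠ ∅ with hNdef
  have hdP := G.pures_pairwise_disjoint
  have hpure_struct : ∀ R : Finset κ, R ⊆ P → Structured U R := fun R hR =>
    structured_of_pairwise_disjoint U hU fun x hx x' hx' hxx' => hdP x (hR hx) x' (hR hx') hxx'
  rcases N.eq_empty_or_nonempty with hN0 | ⟨w, hw⟩
  · -- every member pure: any deletion is structured
    obtain ⟨x, hx⟩ := hW
    refine hdel x hx (hpure_struct _ fun y hy => ?_)
    rw [hPdef, mem_filter]
    refine ⟨mem_of_mem_erase hy, ?_⟩
    by_contra h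
    have : y ∈ N := mem_filter.2 ⟨mem_of_mem_erase hy, h⟩
    rw [hN0] at this; exact notMem_empty y this
  · have hwN : gann U W w ≠ ∅ := (mem_filter.1 hw).2
    have hmem := mem_erase_iff_of_nonpure (U := U) (W := W) hwN
    have hcard : (N.erase w).card ≤ 2 := by rw [card_erase_of_mem hw]; omega
    apply hdel w (mem_filter.1 hw).1
    -- the other non-pure members: none, one (`u`) or two (`u, v`)
    rcases Nat.lt_or_ge (N.erase w).card 1 with h0 | h1
    · have h0' : N.erase w = ∅ := card_eq_zero.1 (by omega)
      refine hpure_struct _ fun y hy => ?_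
      rcases (hmem y).1 hy with h | h
      · exact h
      · rw [h0'] at h; exact absurd h (notMem_empty y)
    rcases Nat.lt_or_ge (N.erase w).card 2 with h1' | h2
    · obtain ⟨u, hu⟩ := card_eq_one.1 (by omega : (N.erase w).card = 1)
      have huE : u ∈ N.erase w := by rw [hu]; exact mem_singleton_self u
      have huN : gann U W u ≠ ∅ := (mem_filter.1 (mem_of_mem_erase huE)).2
      have hst := structured_insert_pures_of_alpha U W hU G.hd (G.hWU u) huN
        (fun χ hχ => G.two_le_card_pureFail_gann hE0 hχ)
      convert hst using 1
      ext y
      rw [hmem y, hu, mem_singleton, mem_insert]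
      constructor
      · rintro (h | h); exacts [Or.inr h, Or.inl h]
      · rintro (h | h); exacts [Or.inr h, Or.inl h]
    · obtain ⟨u, v, huv, huv'⟩ := card_eq_two.1 (by omega : (N.erase w).card = 2)
      have huE : u ∈ N.erase w := by rw [huv']; simp
      have hvE : v ∈ N.erase w := by rw [huv']; simp
      have huN : (gann U W u).Nonempty := Set.nonempty_iff_ne_empty.2 (mem_filter.1 (mem_of_mem_erase huE)).2
      have hvN : (gann U W v).Nonempty := Set.nonempty_iff_ne_empty.2 (mem_filter.1 (mem_of_mem_erase hvE)).2
      have hst := G.structured_insert_two hE0 huv huN hvN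
      convert hst using 1
      ext y
      rw [hmem y, huv', mem_insert, mem_insert, mem_insert, mem_singleton]
      constructor
      · rintro (h | h | h); exacts [Or.inr (Or.inr h), Or.inr (Or.inl h), Or.inl h]
      · rintro (h | h | h); exacts [Or.inr (Or.inr h), Or.inr (Or.inl h), Or.inl h]

end GluedSetting

/-! ### Order six -/

/-- **LG_k at every order when at most three members are non-pure or exactly two are pure.** [this work] -/
theorem localToGlobal_of_card_nonpure_le_three (n : ℕ) (ι : Type) [Fintype ι] (U : Fin (n + 4) → Set (Set ι))
    (hU : ∀ k, IsUpperSet (U k)) (hne : ∀ k, (U k).Nonempty) (hns : ∀ k, U k ≠ Set.univ) (hS : ∀ h, Structured (faceT U h) univ)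
    (hd : ∀ x x', x ≠ x' → Disjoint (esupp (gframe U univ x)) (esupp (gframe U univ x')))
    (hF : ∀ f, CoreFree U f → Structured (faceF U f) univ) (hE0 : ∃ f, CoreFree U f) (hι : ∀ f : ι, ∃ h, h ≠ f)
    (habs : ∀ l, ∃ m, m ≠ l ∧ ¬ U m ⊆ U l) (hdel : ∀ x, ¬ Structured U (univ.erase x))
    (hPN : (univ.filter fun p : Fin (n + 4) => gann U univ p = ∅).card = 2 ∨
      (univ.filter fun p : Fin (n + 4) => gann U univ p ≠ ∅).card ≤ 3) : False := by
  have hd' : ∀ x ∈ (univ : Finset (Fin (n + 4))), ∀ x' ∈ (univ : Finset (Fin (n + 4))), x ≠ x' →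
      Disjoint (esupp (gframe U univ x)) (esupp (gframe U univ x')) := fun x _ x' _ h => hd x x' h
  have G : GluedSetting U univ :=
    { hU := hU, hne := hne, hWU := mem_univ, hS := hS, hd := hd', hι := hι,
      hF := fun f hf => ⟨hF f hf, faceFConsistent_of_noAbsorber U univ hU hne hns hS hd'
        (fun l _ => by obtain ⟨m, hm, h⟩ := habs l; exact ⟨m, mem_univ m, hm, h⟩) (by simp) hf (hF f hf)⟩ }
  rcases hPN with hP2 | hN3
  · exact false_of_alpha U hU hne hd (fun x hs => hdel x (by convert hs using 2)) (by simp)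
      (fun y χ hχ => G.two_le_card_pureFail_gann hE0 hχ) (Or.inl hP2)
  · exact G.false_of_card_nonpure_le_three hE0 (fun x _ hs => hdel x (by convert hs using 2)) hN3 ⟨0, mem_univ 0⟩

/-- **THEOREM LG6: the local-to-global step at order six.** [this work] -/
theorem localToGlobal_two : LocalToGlobal 2 := by
  intro ι _ U hU hne hns hS hd hF hE0 hι habs hdel
  refine localToGlobal_of_card_nonpure_le_three 2 ι U hU hne hns hS hd hF hE0 hι habs hdel ?_
  -- six members, at least two pure: `|P| = 2` or `|N| ≤ 3`
  have hd' : ∀ x ∈ (univ : Finset (Fin (2 + 4))), ∀ x' ∈ (univ : Finset (Fin (2 + 4))), x ≠ x' →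
      Disjoint (esupp (gframe U univ x)) (esupp (gframe U univ x')) := fun x _ x' _ h => hd x x' h
  have hFc : ∀ f, CoreFree U f → Structured (faceF U f) univ ∧ FaceFConsistent U univ f := fun f hf =>
    ⟨hF f hf, faceFConsistent_of_noAbsorber U univ hU hne hns hS hd'
      (fun l _ => by obtain ⟨m, hm, h⟩ := habs l; exact ⟨m, mem_univ m, hm, h⟩) (by simp) hf (hF f hf)⟩
  have hP2 : 2 ≤ ((univ : Finset (Fin (2 + 4))).filter fun w => gann U univ w = ∅).card :=
    two_le_card_pure U univ hU hne (fun k => mem_univ k) hS hd' hFc hE0 (by simp) hι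
  have hPN : ((univ : Finset (Fin (2 + 4))).filter fun p => gann U univ p = ∅).card +
      ((univ : Finset (Fin (2 + 4))).filter fun p => gann U univ p ≠ ∅).card = 6 := by
    rw [Finset.card_filter_add_card_filter_not (s := univ) (fun p => gann U univ p = ∅)]; simp
  omega

/-- **(TT_6): terminal sextuples are tight.** [this work] -/
theorem terminalTight_three : TerminalTight 3 := terminalTight_of_localToGlobal 2 localToGlobal_two

/-- **THE IDENTICALLY-ZERO MASTER CONJECTURE AT ORDER SIX.**  For increasing events `U₁,…,U₆` on a finite product of two-point spaces,
`E₆(μ_p; 1_{U₁},…,1_{U₆}) = 0` for every `p` in the open cube iff `(U₁,…,U₆) ∈ Z₆`. [this work] -/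
theorem masterFamilyIdentEqIff_six : MasterFamilyIdentEqIff 6 :=
  masterFamilyIdentEqIff_succ_of_terminalTight 2 masterFamilyIdentEqIff_five terminalTight_three

end GluedFrames

end Summit.CriticalPhenomena.PercolationContinuityZ3.Theorems
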